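import Summits.CriticalPhenomena.PercolationContinuityZ3.Theorems.Transplant.FKDoubleFanOneSidedConeABS
import Mathlib.Analysis.SpecificLimits.Basic
import HarnessLib

/-!
# Double fans `K₂ ∨ P_{m+1}`: the SHIFTED-TERMWISE criterion — one `q`-uniform constant `C` replaces the spoke weight `y` in the closure
# statement `HypBaS`

Helper file (`--supports stmt-CriticalPhenomena-4575`), FK sub-lane `prim-bschramm-fk-3` (gen 38); builds on p205010 (kernel theorem, internal audit
signed; external expert review pending).  No named facts, no sorries; standard axioms.  Memo `bschramm/prim-bschramm-fk-3/FAR-CROSS-XIII.md` §1.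

The closure statement `HypBaS q` of `…OneSidedConeS` asks that the whole `b`-spoke `∧²BC_y` (`y ∈ [0,1]`) map every `a`-image `imgA q F w`
(`F, w ∈ InS q`) into the cone `osConeS q`.  On the ten Plücker coordinates `∧²BC_y` is DIAGONAL with entries `(1−y)^{2−k}`, `k ∈ {0,1,2}` the
eigenvalue of the polarisation `T_b` (`opTb`); hence for every constant `C ≥ 0` and the SHIFTED POLARISATION **`shiftTb C`** `= T_b + C·I`,
  `∧²BC_y = α₀(y)·I + α₁(y)·(T_b + C) + α₂(y)·(T_b + C)²`,
  `α₂ = y²/2`, `α₁ = y(1−y) − y²(2C+1)/2`, `α₀ = (1 − (1 + C/2)y)² + (C(C+2)/4)·y²` (**`opBC_eq_shift_poly`**),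
with all three coefficients `≥ 0` as soon as `0 ≤ y ≤ 2/(2C+3)`.  Consequently (**`hypBaS_of_shift`**): if for ONE constant `C ≥ 0`
  **(ST_C)** `HypShiftS q C`: `(T_b + C)(imgA q F w) ∈ osConeS q` for all `F, w ∈ InS q`,
then the bi-dual `osConeS q` is `(T_b + C)`-stable (self-adjointness `pairH_shiftTb`), hence `∧²BC_y`-stable for `y ≤ 2/(2C+3)`, hence — composing
small spokes, `∧²BC_y ∧²BC_{y'} = ∧²BC_{y+y'−yy'}` — for every `y < 1`, and for `y = 1` by continuity; this is `HypBaS q`, and with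
`negCorr_spokes_cross_far_of_hypBaS` the far cross-apex theorem for all middles follows (**`negCorr_spokes_cross_far_of_shift`**, `0 < q ≤ 1`).
The point: (ST_C) has one parameter less than `HypBaS` (no spoke weight), and `C = 0` is the termwise statement, which is false below
`q_T = 0.423…` (`…TermwiseThreshold`) — numerically (kit j270762/j271011, cutting planes over `InS × InS`) (ST_C) holds with `C = 1` at every
tested `q ∈ [0.03, 0.8]` while `C = 0` is separated.
[folklore]
-/

noncomputable section

namespace Summit.CriticalPhenomena.PercolationContinuityZ3.Theorems

namespace FK

namespace ThreeApex

open Filter Topology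

/-! ### The shifted polarisation `T_b + C·I` -/

/-- The shifted `b`-polarisation `T_b + C·I` on bivectors. [folklore] -/
def shiftTb (C : ℝ) (β : Biv) : Biv := Biv.add (opTb β) (Biv.smul C β)

/-- `T_b + C·I` passes through `Biv.lin3`. [folklore] -/
theorem shiftTb_lin3 (C a b c : ℝ) (β γ δ : Biv) :
    shiftTb C (Biv.lin3 a β b γ c δ) = Biv.lin3 a (shiftTb C β) b (shiftTb C γ) c (shiftTb C δ) := by
  ext <;> simp only [shiftTb, opTb, Biv.lin3, Biv.add, Biv.smul] <;> ring

/-- `T_b + C·I` commutes with scalars. [folklore] -/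
theorem shiftTb_smul (C c : ℝ) (β : Biv) : shiftTb C (Biv.smul c β) = Biv.smul c (shiftTb C β) := by
  ext <;> simp only [shiftTb, opTb, Biv.add, Biv.smul] <;> ring

/-- `T_b + C·I` is self-adjoint for `pairH`. [folklore] -/
theorem pairH_shiftTb (q C : ℝ) (β γ : Biv) : pairH q (shiftTb C β) γ = pairH q β (shiftTb C γ) := by
  simp only [shiftTb, Biv.add, Biv.smul, pairH, opTb]; ring

/-- **`∧²BC_y` is a quadratic polynomial in `T_b + C·I`** (exact operator identity on all bivectors). [folklore] -/
theorem opBC_eq_shift_poly (C y : ℝ) (β : Biv) :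
    opBC y β =
      Biv.lin3 ((1 - y) ^ 2 - y * (1 - y) * C + y ^ 2 * (C * (C + 1) / 2)) β (y * (1 - y) - y ^ 2 * ((2 * C + 1) / 2)) (shiftTb C β)
        (y ^ 2 / 2) (shiftTb C (shiftTb C β)) := by
  ext <;> simp only [opBC, opTb, opWb, shiftTb, Biv.lin3, Biv.add, Biv.smul] <;> ring

/-- The constant coefficient is a sum of two squares: `α₀ = (1 − (1 + C/2)y)² + (C(C+2)/4)·y²`. [folklore] -/
theorem shift_alpha0_eq (C y : ℝ) :
    (1 - y) ^ 2 - y * (1 - y) * C + y ^ 2 * (C * (C + 1) / 2) = (1 - (1 + C / 2) * y) ^ 2 + C * (C + 2) / 4 * y ^ 2 := by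
  ring

/-! ### The shifted closure statement and the stability of the cone -/

/-- **(ST_C)**: the shifted polarisation maps every `a`-image over `InS` into the cone. [folklore] -/
def HypShiftS (q C : ℝ) : Prop := ∀ F w : V5, InS q F → InS q w → shiftTb C (imgA q F w) ∈ osConeS q

/-- Under (ST_C) the `InS`-dual is `(T_b + C)`-stable. [folklore] -/
theorem OSDualS.shift {q C : ℝ} {γ : Biv} (hγ : OSDualS q γ) (h : HypShiftS q C) : OSDualS q (shiftTb C γ) :=
  fun F w hF hw => by rw [← pairH_shiftTb]; exact h F w hF hw γ hγ

/-- **Under (ST_C) the cone is `(T_b + C)`-stable.** [folklore] -/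
theorem shiftTb_mem_osConeS {q C : ℝ} (h : HypShiftS q C) {β : Biv} (hβ : β ∈ osConeS q) : shiftTb C β ∈ osConeS q :=
  fun γ hγ => by rw [pairH_shiftTb]; exact hβ _ (hγ.shift h)

/-- The cone is closed under three-term non-negative combinations. [folklore] -/
theorem lin3_mem_osConeS {q a b c : ℝ} {β γ δ : Biv} (ha : 0 ≤ a) (hb : 0 ≤ b) (hc : 0 ≤ c) (hβ : β ∈ osConeS q)
    (hγ : γ ∈ osConeS q) (hδ : δ ∈ osConeS q) : Biv.lin3 a β b γ c δ ∈ osConeS q := fun ε hε => by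
  rw [pairH_lin3_left]
  exact add_nonneg (add_nonneg (mul_nonneg ha (hβ ε hε)) (mul_nonneg hb (hγ ε hε))) (mul_nonneg hc (hδ ε hε))

/-- **Small spokes**: under (ST_C), `∧²BC_y` maps the cone into itself for `0 ≤ y ≤ 2/(2C+3)`. [folklore] -/
theorem opBC_mem_osConeS_small {q C : ℝ} (hC : 0 ≤ C) (h : HypShiftS q C) {y : ℝ} (hy0 : 0 ≤ y) (hy : y * (2 * C + 3) ≤ 2)
    {β : Biv} (hβ : β ∈ osConeS q) : opBC y β ∈ osConeS q := by
  rw [opBC_eq_shift_poly C y β]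
  refine lin3_mem_osConeS ?_ ?_ (by positivity) hβ (shiftTb_mem_osConeS h hβ) (shiftTb_mem_osConeS h (shiftTb_mem_osConeS h hβ))
  · rw [shift_alpha0_eq]; positivity
  · have e : y * (1 - y) - y ^ 2 * ((2 * C + 1) / 2) = y * (2 - y * (2 * C + 3)) / 2 := by ring
    rw [e]; exact div_nonneg (mul_nonneg hy0 (by linarith)) (by norm_num)

/-- `∧²BC_0 = id`. [folklore] -/
theorem opBC_zero (β : Biv) : opBC 0 β = β := by
  ext <;> simp [opBC, opTb, opWb, Biv.lin3, Biv.add, Biv.smul]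

/-- **All spokes `y < 1`**, by composing small spokes: with `y_C = 2/(2C+3)`, every `y` with `(1 − y_C)^n ≤ 1 − y` is reached by `n` spokes of
weight `≤ y_C`. [folklore] -/
theorem opBC_mem_osConeS_of_pow {q C : ℝ} (hC : 0 ≤ C) (h : HypShiftS q C) :
    ∀ (n : ℕ) {y : ℝ}, 0 ≤ y → (1 - 2 / (2 * C + 3)) ^ n ≤ 1 - y → ∀ {β : Biv}, β ∈ osConeS q → opBC y β ∈ osConeS q := by
  intro n
  induction n with
  | zero =>
    intro y hy0 hy β hβ
    have : y = 0 := by simp at hy; linarith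
    subst this; rwa [opBC_zero]
  | succ n ih =>
    intro y hy0 hy β hβ
    have hC3 : 0 < 2 * C + 3 := by linarith
    by_cases hsmall : y * (2 * C + 3) ≤ 2
    · exact opBC_mem_osConeS_small hC h hy0 hsmall hβ
    · rw [not_le] at hsmall
      -- y > y_C: peel off one spoke of weight y_C
      set yC : ℝ := 2 / (2 * C + 3) with hyC
      have hyC0 : 0 ≤ yC := by positivity
      have hyC1 : yC < 1 := by rw [hyC, div_lt_one hC3]; linarith
      have hyCy : yC < y := by rw [hyC, div_lt_iff₀ hC3]; linarith
      set y' : ℝ := (y - yC) / (1 - yC) with hy'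
      have h1 : 0 < 1 - yC := by linarith
      have hy'0 : 0 ≤ y' := div_nonneg (by linarith) h1.le
      have hy'1 : (1 - yC) ^ n ≤ 1 - y' := by
        have e : 1 - y' = (1 - y) / (1 - yC) := by rw [hy']; field_simp; ring
        rw [e, le_div_iff₀ h1]
        calc (1 - yC) ^ n * (1 - yC) = (1 - yC) ^ (n + 1) := by ring
          _ ≤ 1 - y := hy
      have hmem : opBC y' β ∈ osConeS q := ih hy'0 hy'1 hβ
      have hcomp : opBC yC (opBC y' β) = opBC y β := by
        rw [opBC_opBC]
        congr 1
        rw [hy']; field_simp; ring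
      rw [← hcomp]
      exact opBC_mem_osConeS_small hC h hyC0 (by rw [hyC, div_mul_cancel₀ _ hC3.ne']) hmem

/-- **Under (ST_C) every spoke `∧²BC_y`, `0 ≤ y < 1`, maps the cone into itself.** [folklore] -/
theorem opBC_mem_osConeS_of_lt_one {q C : ℝ} (hC : 0 ≤ C) (h : HypShiftS q C) {y : ℝ} (hy0 : 0 ≤ y) (hy1 : y < 1) {β : Biv}
    (hβ : β ∈ osConeS q) : opBC y β ∈ osConeS q := by
  have hC3 : 0 < 2 * C + 3 := by linarith
  have hρ0 : 0 ≤ 1 - 2 / (2 * C + 3) := by rw [sub_nonneg, div_le_one hC3]; linarith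
  have h2 : 0 < 2 / (2 * C + 3) := by positivity
  have hρ1 : 1 - 2 / (2 * C + 3) < 1 := by linarith
  obtain ⟨n, hn⟩ := exists_pow_lt_of_lt_one (sub_pos.2 hy1) hρ1
  exact opBC_mem_osConeS_of_pow hC h n hy0 hn.le hβ

/-- The pairing `y ↦ ⟪∧²BC_y β, γ⟫` written as a quadratic polynomial in `y`. [folklore] -/
theorem pairH_opBC_poly (q y : ℝ) (β γ : Biv) :
    pairH q (opBC y β) γ = (1 - y) ^ 2 * pairH q β γ + y * (1 - y) * pairH q (opTb β) γ + y ^ 2 * pairH q (opWb β) γ := by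
  rw [opBC, pairH_lin3_left]

/-- **The full spoke `y = 1` by continuity**: if `∧²BC_y β` lies in the (closed) cone for all `y ∈ [0,1)`, then so does `∧²BC_1 β`. [folklore] -/
theorem opBC_one_mem_osConeS_of_lt {q : ℝ} {β : Biv} (hβ : ∀ y : ℝ, 0 ≤ y → y < 1 → opBC y β ∈ osConeS q) :
    opBC 1 β ∈ osConeS q := by
  intro γ hγ
  set g : ℝ → ℝ := fun y => (1 - y) ^ 2 * pairH q β γ + y * (1 - y) * pairH q (opTb β) γ + y ^ 2 * pairH q (opWb β) γ with hg
  have hcont : Continuous g := by rw [hg]; continuity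
  have hlim : Tendsto g (𝓝[<] (1 : ℝ)) (𝓝 (g 1)) := (hcont.tendsto 1).mono_left nhdsWithin_le_nhds
  have hev : ∀ᶠ y in 𝓝[<] (1 : ℝ), 0 ≤ g y := by
    filter_upwards [Ioo_mem_nhdsLT (zero_lt_one' ℝ)] with y hy
    rw [hg]; dsimp only; rw [← pairH_opBC_poly]; exact hβ y hy.1.le hy.2 γ hγ
  have := ge_of_tendsto hlim hev
  rw [hg] at this; dsimp only at this
  rwa [pairH_opBC_poly]

/-- **Under (ST_C) every spoke `∧²BC_y`, `y ∈ [0,1]`, maps the cone into itself.** [folklore] -/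
theorem opBC_mem_osConeS_of_shift {q C : ℝ} (hC : 0 ≤ C) (h : HypShiftS q C) {y : ℝ} (hy0 : 0 ≤ y) (hy1 : y ≤ 1) {β : Biv}
    (hβ : β ∈ osConeS q) : opBC y β ∈ osConeS q := by
  rcases lt_or_eq_of_le hy1 with hlt | rfl
  · exact opBC_mem_osConeS_of_lt_one hC h hy0 hlt hβ
  · exact opBC_one_mem_osConeS_of_lt fun y' hy'0 hy'1 => opBC_mem_osConeS_of_lt_one hC h hy'0 hy'1 hβ

/-- **(ST_C) ⟹ (CL_S)**: the shifted-termwise statement for one `C ≥ 0` implies `HypBaS q`. [folklore] -/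
theorem hypBaS_of_shift {q C : ℝ} (hC : 0 ≤ C) (h : HypShiftS q C) : HypBaS q :=
  fun _ _ _ hF hw hy0 hy1 => opBC_mem_osConeS_of_shift hC h hy0 hy1 (imgA_mem_osConeS hF hw)

/-- **(ST_C) ⟹ the algebra-level far theorem** (`0 < q ≤ 1`). [folklore] -/
theorem rayleigh_crossFar_of_shift {q C : ℝ} (hq0 : 0 < q) (hq1 : q ≤ 1) (hC : 0 ≤ C) (h : HypShiftS q C) :
    ∀ (mids : List (ℝ × ℝ × ℝ)), UnitBlocks mids → ∀ rd : ℝ, 0 ≤ rd → rd ≤ 1 → ∀ u s : V5, InKE q u → InKE q s →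
      0 ≤ crossFarZ q mids rd u s 1 0 * crossFarZ q mids rd u s 0 1 - crossFarZ q mids rd u s 1 1 * crossFarZ q mids rd u s 0 0 :=
  rayleigh_crossFar_of_hypBaS hq0 hq1 (hypBaS_of_shift hC h)

open MeasureTheory Literature.Probability.LatticeModels Literature.Probability.Percolation
open scoped Classical

variable {V : Type*} [Fintype V]

section Setting

variable {a b : V} {c : ℕ → V} {m : ℕ}
variable (hab : a ≠ b) (hinj : ∀ j k, j ≤ m → k ≤ m → c j = c k → j = k) (hca : ∀ j, j ≤ m → c j ≠ a) (hcb : ∀ j, j ≤ m → c j ≠ b)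
include hab hinj hca hcb

/-- **(ST_C) ⟹ NEGATIVE CORRELATION OF EVERY CROSS-APEX PAIR AT EVERY DISTANCE** (`0 < q ≤ 1`, one constant `C ≥ 0`; every weighted double
fan, every middle word). [folklore] -/
theorem negCorr_spokes_cross_far_of_shift (hcard : Fintype.card V = m + 3) {q C : ℝ} (hq0 : 0 < q) (hq1 : q ≤ 1) (hC : 0 ≤ C)
    (w : Sym2 V → unitInterval) (hsupp : ∀ e, e ∉ dfPairs a b c m → w e = 0) (h : HypShiftS q C) {j k : ℕ} (hjk : j < k) (hk : k ≤ m) :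
    (rcMeasureW w q ∅).real ({ω : BondConfig V | s(a, c j) ∈ ω} ∩ {ω | s(b, c k) ∈ ω}) ≤
      (rcMeasureW w q ∅).real {ω : BondConfig V | s(a, c j) ∈ ω} * (rcMeasureW w q ∅).real {ω : BondConfig V | s(b, c k) ∈ ω} :=
  negCorr_spokes_cross_far_of_hypBaS hab hinj hca hcb hcard hq0 hq1 w hsupp (hypBaS_of_shift hC h) hjk hk

end Setting

end ThreeApex

end FK

end Summit.CriticalPhenomena.PercolationContinuityZ3.Theorems
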